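import Mathlib
import HarnessLib

/-!
# Deligne–Serre 1974, §7: subgroups of `GL₂(𝔽_ℓ)` with few characteristic polynomials are bounded

Topic `Literature/NumberTheory/GaloisRepresentations`. NAMED FACT (D-0014), no proof.

P. Deligne, J.-P. Serre, *Formes modulaires de poids 1*, Ann. Sci. ÉNS (4) 7 (1974), 507–530,
§7 (pp. 523–524; verbatim):

> **7.1.** Soient `η` et `M` deux nombres positifs. Nous aurons à considérer la propriété suivante
> d'un sous-groupe `G` de `GL₂(𝐅_ℓ)` :
> `C(η, M)`. – Il existe une partie `H` de `G` telle que `|H| ≥ (1 − η)|G|`, et que l'ensemble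
> des polynômes `det(1 − hT)`, `h ∈ H`, ait au plus `M` éléments.
> Nous dirons que `G` est *semi-simple* si la représentation identique `G → GL₂(𝐅_ℓ)` est
> semi-simple.
>
> **PROPOSITION 7.2.** – Soient `η < 1/2` et `M ≥ 0`. Il existe une constante `A = A(η, M)`
> telle que, pour tout nombre premier `ℓ`, et tout sous-groupe semi-simple `G` de `GL₂(𝐅_ℓ)`
> satisfaisant à `C(η, M)`, on ait `|G| ≤ A`.

(The printed proof, pp. 524–525, is a case analysis over Dickson's list — `G ⊇ SL₂`, `G` in a
Cartan subgroup, in its normaliser, or with image `𝔖₄/𝔄₄/𝔄₅` in `PGL₂` — counting elements with a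
given characteristic polynomial.) This is the group-theoretic finiteness step of Deligne–Serre's
construction of the Galois representation of a weight-one form (their Lemmas 8.3–8.4: the images
`G_ℓ = ρ̄_ℓ(Gal)` satisfy `C(η, M)` by the Rankin mean-square estimate Prop. 5.5 and Čebotarev, hence
`|G_ℓ| ≤ A` for infinitely many `ℓ`); it is field-of-definition agnostic and is the step route
`Langlands/BianchiDeligneSerre` transports verbatim to imaginary quadratic fields (support item
`Summit.Langlands.Langlands.Theses.BianchiDeligneSerre.DeligneSerreTransportK`, step (iv) of its
proof plan).

## Rendering

* `G` ranges over subgroups of `GL (Fin 2) (ZMod ℓ)`, `ℓ` prime (the printed `GL₂(𝐅_ℓ)`, prime field;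
  Deligne–Serre apply 7.2 at primes split in the coefficient field, §8, "le corps résiduel
  correspondant est égal à `𝐅_ℓ`").
* For `h ∈ GL₂` the polynomial `det(1 − hT) = 1 − tr(h)T + det(h)T²` and the characteristic
  polynomial `det(T − h) = T² − tr(h)T + det(h)` determine each other, so "the set of `det(1 − hT)`,
  `h ∈ H`, has at most `M` elements" is rendered with `Matrix.charpoly` (same cardinality).
* "semi-simple" = the natural representation of `G` on `𝐅_ℓ²` is a semisimple `𝐅_ℓ[G]`-module
  (`Representation.asModule`, `IsSemisimpleModule`).
* `η` is taken in `(0, 1/2)` ("deux nombres positifs", "`η < 1/2`"); `A` is a natural number bounding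
  `Nat.card G`.

## References

* P. Deligne, J.-P. Serre, *Formes modulaires de poids 1*, Ann. Sci. École Norm. Sup. (4) 7 (1974),
  507–530, §7.1, Prop. 7.2 (p. 524), Lemmes 8.3–8.4 (p. 525). [DeligneSerre1974]
  (read: `lit read doi:10.24033/asens.1277`, pp. 18–20 of the materialised text)
-/

noncomputable section

namespace Literature.NumberTheory.GaloisRepresentations

namespace DeligneSerre

variable {ℓ : ℕ}

/-- The natural two-dimensional representation of a subgroup `G ≤ GL₂(𝐅_ℓ)` on `𝐅_ℓ²`
("la représentation identique `G → GL₂(𝐅_ℓ)`", Deligne–Serre 1974, §7.1).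
[cite: DeligneSerre1974, §7.1] -/
def natRep (G : Subgroup (GL (Fin 2) (ZMod ℓ))) : Representation (ZMod ℓ) G (Fin 2 → ZMod ℓ) :=
  (Units.coeHom (Module.End (ZMod ℓ) (Fin 2 → ZMod ℓ))).comp
    (Matrix.GeneralLinearGroup.toLin.toMonoidHom.comp G.subtype)

/-- `G ≤ GL₂(𝐅_ℓ)` is **semi-simple** in the sense of Deligne–Serre 1974, §7.1: its natural
representation on `𝐅_ℓ²` is semisimple (a semisimple `𝐅_ℓ[G]`-module).
[cite: DeligneSerre1974, §7.1] -/
def IsSemisimpleSubgroup (G : Subgroup (GL (Fin 2) (ZMod ℓ))) : Prop :=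
  IsSemisimpleModule (MonoidAlgebra (ZMod ℓ) G) (natRep G).asModule

/-- **Condition `C(η, M)`** (Deligne–Serre 1974, §7.1): there is a subset `H ⊆ G` with
`|H| ≥ (1 − η)|G|` such that the characteristic polynomials of the elements of `H` form a set of at
most `M` elements (printed with `det(1 − hT)`; equivalent datum for invertible `2 × 2` matrices).
[cite: DeligneSerre1974, §7.1 condition C(η, M)] -/
def CondC (G : Subgroup (GL (Fin 2) (ZMod ℓ))) (η : ℝ) (M : ℕ) : Prop :=
  ∃ H : Finset (GL (Fin 2) (ZMod ℓ)), (↑H : Set (GL (Fin 2) (ZMod ℓ))) ⊆ (G : Set (GL (Fin 2) (ZMod ℓ))) ∧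
    (1 - η) * (Nat.card G : ℝ) ≤ (H.card : ℝ) ∧
    (H.image fun h : GL (Fin 2) (ZMod ℓ) => Matrix.charpoly ((h : GL (Fin 2) (ZMod ℓ)) : Matrix (Fin 2) (Fin 2) (ZMod ℓ))).card ≤ M

end DeligneSerre

/-- **Deligne–Serre 1974, Proposition 7.2.** "Soient `η < 1/2` et `M ≥ 0`. Il existe une constante
`A = A(η, M)` telle que, pour tout nombre premier `ℓ`, et tout sous-groupe semi-simple `G` de
`GL₂(𝐅_ℓ)` satisfaisant à `C(η, M)`, on ait `|G| ≤ A`." For every `0 < η < 1/2` and `M` there is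
`A` such that for every prime `ℓ` and every subgroup `G ≤ GL (Fin 2) (ZMod ℓ)` whose natural
representation is semisimple and which satisfies `C(η, M)`, `Nat.card G ≤ A`. Grounds step (iv) of
`Summit.Langlands.Langlands.Theses.BianchiDeligneSerre.DeligneSerreTransportK`.
[cite: DeligneSerre1974, Prop. 7.2 (p. 524)] -/
def DeligneSerre1974_prop72_card_le_of_condC : Prop :=
  ∀ η : ℝ, 0 < η → η < 1 / 2 → ∀ M : ℕ, ∃ A : ℕ,
    ∀ (ℓ : ℕ) [Fact ℓ.Prime] (G : Subgroup (GL (Fin 2) (ZMod ℓ))),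
      DeligneSerre.IsSemisimpleSubgroup G → DeligneSerre.CondC G η M → Nat.card G ≤ A

end Literature.NumberTheory.GaloisRepresentations

end
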